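import Literature.NumberTheory.LFunctions.SuzukiScrewLineRepairedEq48
import Literature.NumberTheory.LFunctions.SuzukiScrewLineRepairedThm44MeanZero
import HarnessLib

/-!
# The repaired CJM Thm 4.4 reduced to the zero expansion of `⟨φ,φ⟩_{G_g}` under RH

LINE 1 — LABEL: RH-FREE DOOR (an implication between typed statements; theorems only, no definition,
no named fact). bears_on: B-C/B-P (LADDER-RH COLUMN 6 DBR). WHAT THIS IS NOT: the remaining input —
under RH, `⟨φ,φ⟩_{G_g} = Σ_γ m_γ |(φ̂(γ) − φ̂(0))/γ|²` for every test `φ` (CJM (4.9) applied to (2.2),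
"noting the symmetry `γ ↦ −γ`", TeX l.1297–1300; a statement about the hermitian form of [Su22] ONLY,
no screw line) — is NOT proved here; `Suzuki2025_thm44R` stays an open RH-CONSEQUENCE record until it
is; nothing here bears on the truth of RH.

Source: M. Suzuki, Canad. J. Math. 2025 = arXiv:2301.00421v3, proof of Thm 4.4 (TeX l.1286–1300).

## What is proved
* `Suzuki2025_thm44R_clause2_of_form_expansion` — if, under RH, `⟨φ,φ⟩_{G_g}` (the tree's
  `zetaScrewForm univ φ φ`) equals `Σ_ρ m_ρ‖φ̂(γ_ρ) − φ̂(0)‖²/‖γ_ρ‖²` for every test `φ`, then clause 2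
  of the repaired Thm 4.4 holds (by (4.8)ᴿ = `Suzuki2025_eq48R`);
* `Suzuki2025_thm44R_of_form_expansion` — hence the whole record `Suzuki2025_thm44R`
  (`Suzuki2025_thm44R_iff_clause2`, conjunct (i) being the theorem `Suzuki2025_thm44R_i_holds`).
So the ONLY open input of `Suzuki2025_thm44R` is the displayed hermitian-form identity (successor map:
adapt `ZetaScrewProp31Proofs.hasSum_term`, which does the derivative-weight case, to plain test weights).

## References
* [Suzuki2025WeilHilbertSpace] CJM 2025 = arXiv:2301.00421v3, Thm 4.4 (TeX l.1274–1284), proof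
  (l.1286–1300), (4.9) (l.1222–1226), (2.2) (l.550–553).
-/

noncomputable section

open MeasureTheory Complex Filter Set Real
open scoped ComplexConjugate Topology

namespace Literature.NumberTheory.LFunctions

/-- **Clause 2 of the repaired Thm 4.4 from the zero expansion of `⟨φ,φ⟩_{G_g}` under RH**: if
`RH ⟹ ⟨φ,φ⟩_{G_g} = Σ_ρ m_ρ‖φ̂(γ_ρ) − φ̂(0)‖²/‖γ_ρ‖²` for all test `φ`, then
`RH ⟹ ‖P̂ᴿ_φ‖² = π⟨φ,φ⟩_{G_g}` for all test `φ` ((4.8)ᴿ, `Suzuki2025_eq48R`). RH-FREE door.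
[cite: Suzuki2025WeilHilbertSpace, proof of Thm. 4.4 (TeX l.1286–1300); erratum E21] -/
theorem Suzuki2025_thm44R_clause2_of_form_expansion
    (h : RiemannHypothesis → ∀ φ : ℝ → ℂ, IsWeilTest φ →
      zetaScrewForm univ φ φ = ((∑' ρ : ZetaZeros.riemannZetaNontrivialZeros,
        (riemannZetaZeroOrder (ρ : ℂ) : ℝ) * ‖suzukiHat φ (suzukiZeroParam (ρ : ℂ)) - suzukiHat φ 0‖ ^ 2 /
          ‖suzukiZeroParam (ρ : ℂ)‖ ^ 2 : ℝ) : ℂ)) :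
    RiemannHypothesis → ∀ φ : ℝ → ℂ, IsWeilTest φ →
      ((∫ x : ℝ, ‖screwPhatR φ x‖ ^ 2 : ℝ) : ℂ) = Real.pi * zetaScrewForm univ φ φ := by
  intro hRH φ hφ
  rw [(Suzuki2025_eq48R hRH hφ).2, h hRH φ hφ]
  push_cast
  ring

/-- **The repaired CJM Thm 4.4 from the zero expansion of `⟨φ,φ⟩_{G_g}` under RH** (conjunct (i)
is the theorem `Suzuki2025_thm44R_i_holds`; conjunct (ii) by the previous door). RH-FREE door: the
only open input of the record `Suzuki2025_thm44R` is the displayed hermitian-form identity.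
[cite: Suzuki2025WeilHilbertSpace, Thm. 4.4 (TeX l.1274–1284) and its proof (l.1286–1300); erratum E21] -/
theorem Suzuki2025_thm44R_of_form_expansion
    (h : RiemannHypothesis → ∀ φ : ℝ → ℂ, IsWeilTest φ →
      zetaScrewForm univ φ φ = ((∑' ρ : ZetaZeros.riemannZetaNontrivialZeros,
        (riemannZetaZeroOrder (ρ : ℂ) : ℝ) * ‖suzukiHat φ (suzukiZeroParam (ρ : ℂ)) - suzukiHat φ 0‖ ^ 2 /
          ‖suzukiZeroParam (ρ : ℂ)‖ ^ 2 : ℝ) : ℂ)) :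
    Suzuki2025_thm44R :=
  Suzuki2025_thm44R_iff_clause2.2 (Suzuki2025_thm44R_clause2_of_form_expansion h)

end Literature.NumberTheory.LFunctions
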